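import Literature.Probability.LatticeModels.LatticeGreenRiemannSum
import Mathlib.MeasureTheory.Integral.Prod
import Mathlib.MeasureTheory.Integral.IntervalIntegral.FundThmCalculus
import Mathlib.Analysis.SpecialFunctions.Integrals.Basic
import HarnessLib

/-!
# The lattice Coulomb energy of a line charge grows linearly in `d ≥ 4`
(the perimeter law of the massless lattice Gaussian field)

For the lattice Green function `G = latticeGreen` of `ℤ^d` (`LatticeGreenFunction.lean`:
`G(z) = ∫_{[-π,π]^d} cos(p·z)/ε(p) dp/(2π)^d`, `ε(p) = ∑ᵢ (1 - cos pᵢ)`, i.e. twice the Green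
function of `-Δ_{ℤ^d}`), this file introduces the **Coulomb (Green-function) energy**
`greenEnergy S f = ∑_{x,y ∈ S} f(x) f(y) G(x - y)` of a real charge distribution `f` supported in
a finite set `S ⊆ ℤ^d`, and PROVES:

* `greenEnergy_eq_integral` (`d ≥ 3`): the Fourier (Plancherel) representation
  `greenEnergy S f = (2π)^{-d} ∫_{[-π,π]^d} |f̂(p)|² / ε(p) dp`,
  `|f̂(p)|² = (∑ f cos(p·x))² + (∑ f sin(p·x))²`; hence `greenEnergy_nonneg` (the energy is a
  positive-semidefinite quadratic form), the parallelogram law and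
  `greenEnergy_sub_le : E(f - g) ≤ 2E(f) + 2E(g)`; translation invariance and independence of
  the carrier `S`;
* `greenEnergy_lineCharge_le` (`d ≥ 4`): **the self-energy of the unit line charge on `R`
  consecutive sites is at most `C_d · R`** — by Plancherel it is
  `(2π)^{-d} ∫ F_R(p_k)/ε(p) dp` with the Fejér-type kernel `F_R(θ) = |∑_{t<R} e^{itθ}|²`
  (`fejerSum`), `∫_{-π}^{π} F_R = 2πR` (`integral_fejerSum`), and `1/ε(p) ≤ 1/ε(p')` with `p'`
  the remaining `d - 1 ≥ 3` coordinates, whose inverse dispersion is integrable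
  (`integrable_indicator_inv_dispersion`); Fubini along the `k`-th coordinate
  (`MeasurableEquiv.piFinSuccAbove`). In `d = 3` the same quantity is of order `R log R`.
* `greenEnergy_lineCharge_sub_translate_le` (`d ≥ 4`): the energy of two opposite unit line
  charges on parallel segments of length `R` (two opposite sides of a lattice rectangle) is at
  most `4 C_d R`, whatever their distance.

Context. In the duality / spin-wave analysis of four-dimensional `U(1)` lattice gauge theory
(Guth 1980; Fröhlich–Spencer 1982 §2, final estimate (2.88): `⟨W(ℒ)⟩ ≥ exp[-(1/2β')(ε,ε)]` with
`(ε, ε) ≤ const (L + T)`; Garban–Sepúlveda 2023 (1.3)–(1.5), constant `C_GFF`), the Gaussian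
("free photon") contribution to a rectangular Wilson loop is `exp(-(1/2β)(j_ℒ, (-Δ)⁻¹ j_ℒ))`
for the unit current `j_ℒ` around the loop; on `ℤ^d` the 1-form Laplacian acts componentwise
as `-Δ_{ℤ^d}`, so `(j_ℒ, (-Δ)⁻¹ j_ℒ)` is the sum over the two directions of the loop of the
energies bounded here, whence the PERIMETER behaviour `(j_ℒ,(-Δ)⁻¹j_ℒ) ≤ C(L+T)` in `d ≥ 4`.
This file supplies that potential-theoretic estimate on `ℤ^d`; it does not formalise the
duality transformation itself.

## References

* J. Fröhlich, T. Spencer, *Massless phases and symmetry restoration in abelian gauge theories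
  and spin systems*, Comm. Math. Phys. 83 (1982) 411–454, §2.10, (2.88).
* C. Garban, A. Sepúlveda, *Improved spin-wave estimate for Wilson loops in U(1) lattice gauge
  theory*, IMRN 2023 (arXiv:2107.04021), (1.3)–(1.5).
* A. H. Guth, Phys. Rev. D 21 (1980) 2291–2307.
-/

noncomputable section

namespace Literature.Probability.LatticeModels

open MeasureTheory Filter Topology Finset Real

variable {d : ℕ}

/-! ### The Coulomb energy and its Fourier representation -/

/-- The phase `p · x = ∑ᵢ pᵢ xᵢ` of a lattice point `x ∈ ℤ^d` at momentum `p`. [folklore] -/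
def momPhase (p : Fin d → ℝ) (x : Site d) : ℝ :=
  ∑ i, p i * (x i : ℝ)

/-- `p · (x - y) = p · x - p · y`. [folklore] -/
theorem sum_mul_cast_sub_eq (p : Fin d → ℝ) (x y : Site d) :
    (∑ i, p i * ((x - y) i : ℝ)) = momPhase p x - momPhase p y := by
  simp only [momPhase, Pi.sub_apply, Int.cast_sub, mul_sub, Finset.sum_sub_distrib]

/-- `p · (t e_k) = p_k t`. [folklore] -/
theorem momPhase_single (p : Fin d → ℝ) (k : Fin d) (t : ℤ) :
    momPhase p (Pi.single k t) = p k * t := by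
  unfold momPhase
  rw [Finset.sum_eq_single k (fun i _ hik => by simp [hik])
    (fun h => absurd (Finset.mem_univ k) h)]
  simp

/-- **The lattice Coulomb (Green-function) energy** `∑_{x,y ∈ S} f(x) f(y) G(x - y)` of a
charge distribution `f` on the finite carrier `S ⊆ ℤ^d`, for the lattice Green function
`G = latticeGreen` (twice the Green function of `-Δ_{ℤ^d}`). [folklore] -/
def greenEnergy (S : Finset (Site d)) (f : Site d → ℝ) : ℝ :=
  ∑ x ∈ S, ∑ y ∈ S, f x * f y * latticeGreen (x - y)

/-- `∑_{x,y} f(x) f(y) cos(aₓ - a_y) = (∑ f cos a)² + (∑ f sin a)²`. [folklore] -/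
theorem sum_sum_mul_mul_cos_sub {α : Type*} (S : Finset α) (f : α → ℝ) (a : α → ℝ) :
    ∑ x ∈ S, ∑ y ∈ S, f x * f y * Real.cos (a x - a y) =
      (∑ x ∈ S, f x * Real.cos (a x)) ^ 2 + (∑ x ∈ S, f x * Real.sin (a x)) ^ 2 := by
  simp_rw [Real.cos_sub, sq, Finset.sum_mul_sum, ← Finset.sum_add_distrib]
  refine Finset.sum_congr rfl fun x _ => Finset.sum_congr rfl fun y _ => by ring

variable (d) in
/-- **Fourier representation of the Coulomb energy** (`d ≥ 3`):
`∑_{x,y ∈ S} f(x)f(y)G(x-y) = (2π)^{-d} ∫_{[-π,π]^d} |f̂(p)|²/ε(p) dp` with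
`|f̂(p)|² = (∑ₓ f(x) cos(p·x))² + (∑ₓ f(x) sin(p·x))²` (finite sums commute with the integral;
`cos(p·(x-y)) = cos(p·x)cos(p·y) + sin(p·x)sin(p·y)`). [folklore] -/
theorem greenEnergy_eq_integral (hd : 3 ≤ d) (S : Finset (Site d)) (f : Site d → ℝ) :
    greenEnergy S f =
      (∫ p in brillouin d, ((∑ x ∈ S, f x * Real.cos (momPhase p x)) ^ 2 +
          (∑ x ∈ S, f x * Real.sin (momPhase p x)) ^ 2) / dispersion p) / (2 * π) ^ d := by
  unfold greenEnergy
  have hterm : ∀ x y, f x * f y * latticeGreen (x - y) =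
      (∫ p in brillouin d, f x * f y * greenIntegrand (x - y) p) / (2 * π) ^ d := by
    intro x y
    rw [latticeGreen_eq, integral_const_mul]
    ring
  simp_rw [hterm, ← Finset.sum_div]
  congr 1
  have hint : ∀ x ∈ S, ∀ y ∈ S,
      Integrable (fun p => f x * f y * greenIntegrand (x - y) p) (volume.restrict (brillouin d)) :=
    fun x _ y _ => (integrableOn_greenIntegrand d hd (x - y)).const_mul (f x * f y)
  have h1 : ∀ x ∈ S, ∑ y ∈ S, ∫ p in brillouin d, f x * f y * greenIntegrand (x - y) p =
      ∫ p in brillouin d, ∑ y ∈ S, f x * f y * greenIntegrand (x - y) p :=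
    fun x hx => (integral_finsetSum S fun y hy => hint x hx y hy).symm
  rw [Finset.sum_congr rfl h1,
    ← integral_finsetSum S fun x hx => integrable_finsetSum S fun y hy => hint x hx y hy]
  refine setIntegral_congr_fun (measurableSet_brillouin d) fun p _ => ?_
  have h2 : ∀ x y, f x * f y * greenIntegrand (x - y) p =
      f x * f y * Real.cos (momPhase p x - momPhase p y) / dispersion p := by
    intro x y
    rw [greenIntegrand, sum_mul_cast_sub_eq, mul_div_assoc]
  simp_rw [h2, ← Finset.sum_div, sum_sum_mul_mul_cos_sub]

variable (d) in
/-- The Coulomb energy is non-negative (`d ≥ 3`): the Green function of `ℤ^d` is a positive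
semi-definite kernel. [folklore] -/
theorem greenEnergy_nonneg (hd : 3 ≤ d) (S : Finset (Site d)) (f : Site d → ℝ) :
    0 ≤ greenEnergy S f := by
  rw [greenEnergy_eq_integral d hd]
  refine div_nonneg (setIntegral_nonneg (measurableSet_brillouin d) fun p _ => ?_) (by positivity)
  exact div_nonneg (by positivity) (dispersion_nonneg p)

/-- The parallelogram law of the quadratic form `greenEnergy S`. [folklore] -/
theorem greenEnergy_add_add_greenEnergy_sub (S : Finset (Site d)) (f g : Site d → ℝ) :
    greenEnergy S (f + g) + greenEnergy S (f - g) = 2 * greenEnergy S f + 2 * greenEnergy S g := by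
  simp only [greenEnergy, Pi.add_apply, Pi.sub_apply, Finset.mul_sum, ← Finset.sum_add_distrib]
  refine Finset.sum_congr rfl fun x _ => Finset.sum_congr rfl fun y _ => by ring

variable (d) in
/-- `E(f - g) ≤ 2E(f) + 2E(g)` (`d ≥ 3`; parallelogram law and `E(f + g) ≥ 0`). [folklore] -/
theorem greenEnergy_sub_le (hd : 3 ≤ d) (S : Finset (Site d)) (f g : Site d → ℝ) :
    greenEnergy S (f - g) ≤ 2 * greenEnergy S f + 2 * greenEnergy S g := by
  have h1 := greenEnergy_add_add_greenEnergy_sub S f g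
  have h2 := greenEnergy_nonneg d hd S (f + g)
  linarith

/-- The energy does not depend on the carrier: enlarging `S` by points where `f` vanishes
changes nothing. [folklore] -/
theorem greenEnergy_eq_of_subset {S S' : Finset (Site d)} (h : S ⊆ S') {f : Site d → ℝ}
    (hf : ∀ x ∈ S', x ∉ S → f x = 0) : greenEnergy S' f = greenEnergy S f := by
  unfold greenEnergy
  symm
  have inner : ∀ x, ∑ y ∈ S, f x * f y * latticeGreen (x - y) =
      ∑ y ∈ S', f x * f y * latticeGreen (x - y) := fun x =>
    Finset.sum_subset h fun y hy hyS => by simp [hf y hy hyS]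
  rw [Finset.sum_congr rfl fun x _ => inner x]
  exact Finset.sum_subset h fun x hx hxS => by simp [hf x hx hxS]

/-- Translation invariance of the energy. [folklore] -/
theorem greenEnergy_translate (S : Finset (Site d)) (f : Site d → ℝ) (a : Site d) :
    greenEnergy (S.image fun x => x + a) (fun x => f (x - a)) = greenEnergy S f := by
  unfold greenEnergy
  have hinj : ∀ x ∈ S, ∀ y ∈ S, x + a = y + a → x = y := fun x _ y _ h => add_right_cancel h
  rw [Finset.sum_image hinj]
  refine Finset.sum_congr rfl fun x _ => ?_
  rw [Finset.sum_image hinj]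
  refine Finset.sum_congr rfl fun y _ => ?_
  simp only [add_sub_cancel_right, add_sub_add_right_eq_sub]

/-! ### The Fejér-type kernel `|∑_{t<R} e^{itθ}|²` -/

/-- `F_R(θ) = (∑_{t<R} cos(θt))² + (∑_{t<R} sin(θt))² = |∑_{t<R} e^{iθt}|²` (a Fejér kernel up to
normalisation: `F_R(θ) = sin²(Rθ/2)/sin²(θ/2)`). [folklore] -/
def fejerSum (R : ℕ) (θ : ℝ) : ℝ :=
  (∑ t ∈ Finset.range R, Real.cos (θ * t)) ^ 2 + (∑ t ∈ Finset.range R, Real.sin (θ * t)) ^ 2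

/-- `F_R(θ) = ∑_{s,t<R} cos((s - t)θ)`. [folklore] -/
theorem fejerSum_eq_sum_sum (R : ℕ) (θ : ℝ) :
    fejerSum R θ = ∑ s ∈ Finset.range R, ∑ t ∈ Finset.range R, Real.cos (((s : ℝ) - t) * θ) := by
  have h := sum_sum_mul_mul_cos_sub (Finset.range R) (fun _ => (1 : ℝ)) fun t : ℕ => θ * t
  simp only [one_mul] at h
  rw [fejerSum, ← h]
  refine Finset.sum_congr rfl fun s _ => Finset.sum_congr rfl fun t _ => ?_
  congr 1; ring

/-- `F_R ≥ 0`. [folklore] -/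
theorem fejerSum_nonneg (R : ℕ) (θ : ℝ) : 0 ≤ fejerSum R θ := by
  unfold fejerSum; positivity

/-- `F_R ≤ R²`. [folklore] -/
theorem fejerSum_le (R : ℕ) (θ : ℝ) : fejerSum R θ ≤ (R : ℝ) ^ 2 := by
  rw [fejerSum_eq_sum_sum]
  calc ∑ s ∈ Finset.range R, ∑ t ∈ Finset.range R, Real.cos (((s : ℝ) - t) * θ)
      ≤ ∑ s ∈ Finset.range R, ∑ t ∈ Finset.range R, (1 : ℝ) := by
        gcongr with s _ t _; exact Real.cos_le_one _
    _ = (R : ℝ) ^ 2 := by simp [sq]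

/-- `F_R` is continuous. [folklore] -/
theorem continuous_fejerSum (R : ℕ) : Continuous (fejerSum R) := by
  unfold fejerSum; fun_prop

/-- `∫_{-π}^{π} cos(mθ) dθ = 0` for a non-zero integer `m`. [folklore] -/
theorem integral_cos_int_mul_eq_zero {m : ℤ} (hm : m ≠ 0) :
    ∫ θ in (-π)..π, Real.cos (m * θ) = 0 := by
  have hm' : (m : ℝ) ≠ 0 := Int.cast_ne_zero.2 hm
  have hderiv : ∀ x ∈ Set.uIcc (-π) π,
      HasDerivAt (fun θ => Real.sin (m * θ) / m) (Real.cos (m * x)) x := by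
    intro x _
    have h1 : HasDerivAt (fun θ : ℝ => (m : ℝ) * θ) (m : ℝ) x := by
      simpa using (hasDerivAt_id x).const_mul (m : ℝ)
    have h3 := ((Real.hasDerivAt_sin ((m : ℝ) * x)).comp x h1).div_const (m : ℝ)
    refine h3.congr_deriv ?_
    rw [mul_div_assoc, div_self hm', mul_one]
  rw [intervalIntegral.integral_eq_sub_of_hasDerivAt hderiv
    (by apply Continuous.intervalIntegrable; fun_prop)]
  simp [Real.sin_int_mul_pi, mul_neg, Real.sin_neg]

/-- `∫_{-π}^{π} cos((s - t)θ) dθ = 2π` if `s = t` and `0` otherwise (`s, t ∈ ℕ`). [folklore] -/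
theorem integral_cos_sub_mul (s t : ℕ) :
    ∫ θ in (-π)..π, Real.cos (((s : ℝ) - t) * θ) = if s = t then 2 * π else 0 := by
  split_ifs with h
  · subst h; simp; ring
  · have hm : ((s : ℤ) - t : ℤ) ≠ 0 := by omega
    have h1 := integral_cos_int_mul_eq_zero hm
    push_cast at h1
    exact h1

/-- **`∫_{-π}^{π} F_R(θ) dθ = 2πR`** (orthogonality of the exponentials: only the `R` diagonal
terms `s = t` of `∑_{s,t} cos((s-t)θ)` survive). [folklore] -/
theorem integral_fejerSum (R : ℕ) : ∫ θ in (-π)..π, fejerSum R θ = 2 * π * R := by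
  simp_rw [fejerSum_eq_sum_sum]
  rw [intervalIntegral.integral_finsetSum fun s _ =>
    (continuous_finsetSum _ fun t _ => by fun_prop).intervalIntegrable _ _]
  have h1 : ∀ s ∈ Finset.range R,
      ∫ θ in (-π)..π, ∑ t ∈ Finset.range R, Real.cos (((s : ℝ) - t) * θ) = 2 * π := by
    intro s hs
    rw [intervalIntegral.integral_finsetSum fun t _ => by
      apply Continuous.intervalIntegrable; fun_prop]
    simp_rw [integral_cos_sub_mul]
    rw [Finset.sum_ite_eq, if_pos hs]
  rw [Finset.sum_congr rfl h1]
  simp [mul_comm]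

/-! ### The unit line charge -/

/-- The `R` consecutive lattice sites `t e_k`, `0 ≤ t < R`, of a lattice segment in direction
`k`. [folklore] -/
def lineSites (k : Fin d) (R : ℕ) : Finset (Site d) :=
  (Finset.range R).image fun t : ℕ => Pi.single k (t : ℤ)

/-- The unit line charge: `1` on `lineSites k R`, `0` elsewhere. [folklore] -/
def lineCharge (k : Fin d) (R : ℕ) (x : Site d) : ℝ :=
  if x ∈ lineSites k R then 1 else 0

/-- `t ↦ t e_k` is injective on `ℕ`. [folklore] -/
theorem single_natCast_injective (k : Fin d) :
    Function.Injective fun t : ℕ => (Pi.single k (t : ℤ) : Site d) := by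
  intro s t h
  have h' : ((s : ℤ)) = t := Pi.single_injective (M := fun _ : Fin d => ℤ) k h
  exact_mod_cast h'

/-- Sums over a lattice segment. [folklore] -/
theorem sum_lineSites {M : Type*} [AddCommMonoid M] (k : Fin d) (R : ℕ) (g : Site d → M) :
    ∑ x ∈ lineSites k R, g x = ∑ t ∈ Finset.range R, g (Pi.single k (t : ℤ)) :=
  Finset.sum_image fun _ _ _ _ h => single_natCast_injective k h

/-- `|𝓕(lineCharge)(p)|² = F_R(p_k)`. [folklore] -/
theorem fourierSq_lineCharge (p : Fin d → ℝ) (k : Fin d) (R : ℕ) :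
    (∑ x ∈ lineSites k R, lineCharge k R x * Real.cos (momPhase p x)) ^ 2 +
        (∑ x ∈ lineSites k R, lineCharge k R x * Real.sin (momPhase p x)) ^ 2 =
      fejerSum R (p k) := by
  have h1 : ∀ φ : ℝ → ℝ, ∑ x ∈ lineSites k R, lineCharge k R x * φ (momPhase p x) =
      ∑ t ∈ Finset.range R, φ (p k * t) := by
    intro φ
    have h2 : ∀ x ∈ lineSites k R, lineCharge k R x * φ (momPhase p x) = φ (momPhase p x) :=
      fun x hx => by rw [lineCharge, if_pos hx, one_mul]
    rw [Finset.sum_congr rfl h2, sum_lineSites]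
    refine Finset.sum_congr rfl fun t _ => ?_
    rw [momPhase_single, Int.cast_natCast]
  rw [h1 Real.cos, h1 Real.sin, fejerSum]

variable (d) in
/-- The self-energy of the unit line charge in Fourier form (`d ≥ 3`):
`E(line_R) = (2π)^{-d} ∫_{[-π,π]^d} F_R(p_k)/ε(p) dp`. [folklore] -/
theorem greenEnergy_lineCharge_eq (hd : 3 ≤ d) (k : Fin d) (R : ℕ) :
    greenEnergy (lineSites k R) (lineCharge k R) =
      (∫ p in brillouin d, fejerSum R (p k) / dispersion p) / (2 * π) ^ d := by
  rw [greenEnergy_eq_integral d hd]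
  simp_rw [fourierSq_lineCharge]

/-! ### The main estimate: Fubini along the direction of the segment -/

variable (d) in
/-- `1/ε` is integrable on the Brillouin zone for `d ≥ 3` (set form of
`integrable_indicator_inv_dispersion`). [folklore] -/
theorem integrableOn_inv_dispersion (hd : 3 ≤ d) :
    IntegrableOn (fun p : Fin d → ℝ => 1 / dispersion p) (brillouin d) volume :=
  (integrable_indicator_iff (measurableSet_brillouin d)).1 (integrable_indicator_inv_dispersion d hd)

/-- Dropping one coordinate does not increase the dispersion:
`ε(p') ≤ ε(p)` for `p' = (p_j)_{j ≠ k}`. [folklore] -/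
theorem dispersion_removeNth_le {n : ℕ} (k : Fin (n + 1)) (p : Fin (n + 1) → ℝ) :
    dispersion (fun j => p (k.succAbove j)) ≤ dispersion p := by
  rw [dispersion, dispersion, Fin.sum_univ_succAbove _ k]
  linarith [Real.cos_le_one (p k)]

/-- **Fubini bound.** For `n ≥ 3`, `k : Fin (n+1)` and every `R`,
`∫_{[-π,π]^{n+1}} F_R(p_k)/ε(p) dp ≤ 2πR · ∫_{[-π,π]^n} dq/ε(q)`: bound `1/ε(p) ≤ 1/ε(q)`
(`q` = the other coordinates, a.e. non-zero), split `[-π,π]^{n+1} = [-π,π] × [-π,π]^n` along the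
`k`-th coordinate (`MeasurableEquiv.piFinSuccAbove`, volume preserving) and use
`∫_{-π}^{π} F_R = 2πR`. [folklore] -/
theorem setIntegral_fejerSum_div_dispersion_le {n : ℕ} (hn : 3 ≤ n) (k : Fin (n + 1)) (R : ℕ) :
    ∫ p in brillouin (n + 1), fejerSum R (p k) / dispersion p ≤
      (2 * π * R) * ∫ q in brillouin n, 1 / dispersion q := by
  set e := MeasurableEquiv.piFinSuccAbove (fun _ : Fin (n + 1) => ℝ) k with he
  have hmp : MeasurePreserving e volume volume := volume_preserving_piFinSuccAbove (fun _ => ℝ) k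
  have he_apply : ∀ p : Fin (n + 1) → ℝ, e p = (p k, fun j => p (k.succAbove j)) := fun p => rfl
  -- the majorant, a tensor product
  set g : ℝ × (Fin n → ℝ) → ℝ := fun aq => fejerSum R aq.1 * (1 / dispersion aq.2) with hg
  -- the Brillouin zone is the preimage of the product of the lower-dimensional zones
  have hpre : e ⁻¹' (Set.Icc (-π) π ×ˢ brillouin n) = brillouin (n + 1) := by
    ext p
    simp only [Set.mem_preimage, he_apply, Set.mem_prod, brillouin, Set.mem_univ_pi]
    rw [Fin.forall_iff_succAbove k]
  -- integrability of the majorant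
  have hgi : IntegrableOn g (Set.Icc (-π) π ×ˢ brillouin n) volume := by
    rw [IntegrableOn, Measure.volume_eq_prod, ← Measure.prod_restrict]
    exact ((continuous_fejerSum R).integrableOn_Icc (a := -π) (b := π)).mul_prod
      (integrableOn_inv_dispersion n hn)
  have hgi' : IntegrableOn (g ∘ e) (brillouin (n + 1)) volume := by
    rw [← hpre]; exact (hmp.integrableOn_comp_preimage e.measurableEmbedding).2 hgi
  -- the integral of the majorant factorises
  have hgint : ∫ p in brillouin (n + 1), g (e p) = ∫ aq in Set.Icc (-π) π ×ˢ brillouin n, g aq := by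
    rw [← hpre]; exact hmp.setIntegral_preimage_emb e.measurableEmbedding g _
  have hprod : ∫ aq in Set.Icc (-π) π ×ˢ brillouin n, g aq =
      (∫ a in Set.Icc (-π) π, fejerSum R a) * ∫ q in brillouin n, 1 / dispersion q := by
    rw [Measure.volume_eq_prod, hg]
    exact setIntegral_prod_mul (fejerSum R) (fun q : Fin n → ℝ => 1 / dispersion q) _ _
  have hIcc : ∫ a in Set.Icc (-π) π, fejerSum R a = 2 * π * R := by
    rw [integral_Icc_eq_integral_Ioc, ← intervalIntegral.integral_of_le (by linarith [Real.pi_pos]),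
      integral_fejerSum]
  -- the pointwise bound, almost everywhere on the zone
  have j₀ : Fin n := ⟨0, by omega⟩
  have hnull : ∀ᵐ p : Fin (n + 1) → ℝ, p (k.succAbove j₀) ≠ 0 := by
    have h := Measure.ae_eval_ne (fun _ : Fin (n + 1) => (volume : Measure ℝ)) (k.succAbove j₀) (0 : ℝ)
    rwa [← volume_pi] at h
  have hae : ∀ᵐ p ∂(volume.restrict (brillouin (n + 1))),
      fejerSum R (p k) / dispersion p ≤ g (e p) := by
    rw [ae_restrict_iff' (measurableSet_brillouin (n + 1))]
    filter_upwards [hnull] with p hp0 hpB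
    have hq : (fun j => p (k.succAbove j)) ∈ brillouin n := fun j _ => hpB (k.succAbove j) (Set.mem_univ _)
    have hq0 : (fun j => p (k.succAbove j)) ≠ 0 := fun h => hp0 (by simpa using congrFun h j₀)
    have hεq : 0 < dispersion (fun j => p (k.succAbove j)) := dispersion_pos_of_mem_brillouin hq hq0
    rw [he_apply, hg]
    simp only
    rw [div_eq_mul_one_div]
    exact mul_le_mul_of_nonneg_left (one_div_le_one_div_of_le hεq (dispersion_removeNth_le k p))
      (fejerSum_nonneg R _)
  -- assemble
  calc ∫ p in brillouin (n + 1), fejerSum R (p k) / dispersion p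
      ≤ ∫ p in brillouin (n + 1), g (e p) :=
        integral_mono_of_nonneg
          (ae_of_all _ fun p => div_nonneg (fejerSum_nonneg R _) (dispersion_nonneg p)) hgi' hae
    _ = (2 * π * R) * ∫ q in brillouin n, 1 / dispersion q := by rw [hgint, hprod, hIcc]

variable (d) in
/-- **The self-energy of a line charge is linear in its length in `d ≥ 4`.** There is a constant
`C = C_d ≥ 0` such that for every direction `k` and every `R`, the Coulomb energy
`∑_{s,t<R} G((s-t)e_k)` of the unit charge on `R` consecutive sites is at most `C · R`. (This is
the perimeter behaviour of the massless Gaussian / spin-wave contribution to Wilson loops in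
four dimensions, Fröhlich–Spencer 1982 (2.88), Garban–Sepúlveda 2023 (1.3)–(1.5); in `d = 3`
the energy is of order `R log R`.) [folklore] -/
theorem greenEnergy_lineCharge_le (hd : 4 ≤ d) :
    ∃ C : ℝ, 0 ≤ C ∧ ∀ (k : Fin d) (R : ℕ),
      greenEnergy (lineSites k R) (lineCharge k R) ≤ C * R := by
  obtain ⟨n, rfl⟩ : ∃ n, d = n + 1 := ⟨d - 1, by omega⟩
  have hn : 3 ≤ n := by omega
  set K : ℝ := ∫ q in brillouin n, 1 / dispersion q with hK
  have hK0 : 0 ≤ K := setIntegral_nonneg (measurableSet_brillouin n) fun q _ =>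
    div_nonneg zero_le_one (dispersion_nonneg q)
  refine ⟨2 * π * K / (2 * π) ^ (n + 1), by positivity, fun k R => ?_⟩
  rw [greenEnergy_lineCharge_eq (n + 1) (by omega) k R]
  calc (∫ p in brillouin (n + 1), fejerSum R (p k) / dispersion p) / (2 * π) ^ (n + 1)
      ≤ (2 * π * R * K) / (2 * π) ^ (n + 1) := by
        gcongr
        exact setIntegral_fejerSum_div_dispersion_le hn k R
    _ = 2 * π * K / (2 * π) ^ (n + 1) * R := by ring

/-! ### Two opposite line charges (two parallel sides of a lattice rectangle) -/

variable (d) in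
/-- **Two opposite unit line charges on parallel segments have energy `O(R)` in `d ≥ 4`,
uniformly in their relative position.** For the constant `C` of `greenEnergy_lineCharge_le`:
the charge `+1` on the segment `x + [0,R) e_k` and `-1` on the segment `x + a + [0,R) e_k` has
Coulomb energy at most `4 C R` (parallelogram bound `E(f - g) ≤ 2E(f) + 2E(g)`, translation
invariance). With `a = T e_l` these are two opposite sides of the `R × T` rectangle at `x` in the
`(k, l)` plane, i.e. one component of the unit current around it. [folklore] -/
theorem greenEnergy_lineCharge_sub_translate_le (hd : 4 ≤ d) :
    ∃ C : ℝ, 0 ≤ C ∧ ∀ (x a : Site d) (k : Fin d) (R : ℕ),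
      greenEnergy ((lineSites k R).image (fun y => y + x) ∪ (lineSites k R).image (fun y => y + (x + a)))
        (fun y => lineCharge k R (y - x) - lineCharge k R (y - (x + a))) ≤ C * R := by
  obtain ⟨C, hC0, hC⟩ := greenEnergy_lineCharge_le d hd
  have hd3 : 3 ≤ d := by omega
  refine ⟨4 * C, by positivity, fun x a k R => ?_⟩
  set S₁ := (lineSites k R).image (fun y => y + x) with hS₁
  set S₂ := (lineSites k R).image (fun y => y + (x + a)) with hS₂
  set f₁ : Site d → ℝ := fun y => lineCharge k R (y - x) with hf₁
  set f₂ : Site d → ℝ := fun y => lineCharge k R (y - (x + a)) with hf₂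
  have hzero : ∀ (b : Site d) (y : Site d), y ∉ (lineSites k R).image (fun y => y + b) →
      lineCharge k R (y - b) = 0 := by
    intro b y hy
    rw [lineCharge, if_neg]
    intro hmem
    exact hy (Finset.mem_image.2 ⟨y - b, hmem, sub_add_cancel y b⟩)
  have h1 : greenEnergy (S₁ ∪ S₂) f₁ = greenEnergy (lineSites k R) (lineCharge k R) := by
    rw [greenEnergy_eq_of_subset Finset.subset_union_left fun y _ hy => hzero x y hy]
    exact greenEnergy_translate (lineSites k R) (lineCharge k R) x
  have h2 : greenEnergy (S₁ ∪ S₂) f₂ = greenEnergy (lineSites k R) (lineCharge k R) := by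
    rw [greenEnergy_eq_of_subset Finset.subset_union_right fun y _ hy => hzero (x + a) y hy]
    exact greenEnergy_translate (lineSites k R) (lineCharge k R) (x + a)
  have h3 := greenEnergy_sub_le d hd3 (S₁ ∪ S₂) f₁ f₂
  have h4 := hC k R
  calc greenEnergy (S₁ ∪ S₂) (fun y => lineCharge k R (y - x) - lineCharge k R (y - (x + a)))
      = greenEnergy (S₁ ∪ S₂) (f₁ - f₂) := rfl
    _ ≤ 2 * greenEnergy (S₁ ∪ S₂) f₁ + 2 * greenEnergy (S₁ ∪ S₂) f₂ := h3
    _ ≤ 4 * C * R := by rw [h1, h2]; linarith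

end Literature.Probability.LatticeModels
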